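import Summits.QuantumFields.BalabanUV.Beta.FP.TowerDoorGaugeRefDefs
import Summits.QuantumFields.BalabanUV.Beta.FP.TowerK2bDoorReadoutPeriodised

/-!
# `BalabanUV.Beta.FP.TowerDoorGaugeCopies` — binder row D1, the row's ONE file, STUB P (P-c), part 1 of 2 (J-NOTE-20 §8∕§9 (2), SPEC-64 v3.2 §14 (3)(b)):
# **THE GAUGE PARAMETER IS LINEAR IN THE ONE-SHOT COLUMN, COPY BY COPY, AND EACH LATTICE COPY's `hlve` WORD ON THE BOX IS `−λℤ`** — the generic `HasSum` bookkeeping through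
# `θ = −(N·W₀)⁻¹·(N·X)` and the finite read-out, the unwrapping of ONE source's periodised field–multiplier column into its lattice copies, and road g54 (C6)
# `treeGauge_readout_eq_reference` fed PART 55's reference objects (the column agreement = the chart's `L`-block covariance `shiftK (−L•t) A = A`)
# (β-function cell `pub-balaban`, BINDER-OWNERS row D1 ∕ (C1) OWNER «beta-an2» gen 77, PART 56; imports PART 55 (over road (C6)) + PART 47; part 2 = `FP/TowerDoorGaugePeriodised`)

WHAT ([folklore] `tsum`∕`HasSum` and finite `Matrix` bookkeeping BY NAME; no `def`, no `def … : Prop`, nothing cited, 0 sorry, default heartbeats).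
§1 generic (finite index types, any summation index): `hasSum_mulVec` (a matrix acts termwise on a convergent vector series — `Pi.hasSum` + `hasSum_sum ∘ mul_left`), **`hasSum_gaugeParam`**
(`det (N·W) ≠ 0`, `(N·W)·θ = −N·X`, `HasSum X_m X` ⟹ `HasSum (m ↦ −(N·W)⁻¹·(N·X_m)) θ`), `hasSum_readout` (the `hlve`-shaped read-out passes to the series), `neg_inv_mulVec_smul`, `readout_smul`,
`mul_mulVec_neg_inv` (the copy solution solves its own (D)-equation); `toBlocks₁₂_mulVec_smul_single` (the one-shot right inverse applied to `c • e_a` at a field row is `c · XN (inl b) (inr (inl a))`).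
§2 (`d = 3`) **`hasSum_perF_inl_source`**: for a torus `T = L • Mc` and any kernel with summable copies, `HasSum (m ↦ A ↑x (L • translate Mc w m) (inl κ) (inr μ)) (perF T A (x, inl κ) (wrapPt T (L•w), inr μ))`
(PART 47 `wrap_eq_translate_neg_quo` ∕ `translate_smul_eq_smul_translate`, re-indexing `Equiv.addLeft`) — PART 52 §2 for ONE source, as a `HasSum`.
§3 (generic `d`, (C6)'s letters on the box `M`, generic root list, G-2's `det ≠ 0` displayed on the box AND on the reference tower): **`treeGauge_readout_eq_neg_lamZ`** — if `θ` solves `(N·W₀)·θ = −N·X_z`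
for the lattice column `X_z b = A ↑b.1 (L•z) (inl b.2) (inr μ)` of an `L`-block covariant kernel, its `hlve` word at `s` is `−lamZ … A μ z ↑s` ((C6) with `X′ := refCol … (z − quo L ↑s)`, `θ′ := refTheta …`,
`hθ′` = PART 55 `refSlice_mul_towerGen_mulVec_refTheta`).
WHAT THIS IS NOT: not the assembled identity `lv (c • e_a) s = c·Σ'_m λℤ` (part 2); not the lattice `hΘ`; the door NOT defined; `hlve` NOT instantiated; nothing of Bałaban's asserted, valued or discharged; 0 estimates;
0∕4 row-D1 binders (hW, hR, D1Tel, D1Rep); v10 NOT filed; v9 p617999 stands; NOT (C1), NOT (T-ID), NOT D1, NEVER «G-an2-4 closed», NOT BetaPertH, NOT continuum, NOT Clay.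

HONEST DEPENDENCY (page 1, mandatory): continuum YM on T⁴ ⇐ BetaPertH ∧ nine spine estimates (0/9 proved); BetaPertH ⇐ (D1) ∧ (D4) ∧ CAP+tail;
G-an2-4 gates asym, D1 and NE2/3/4.  HONEST FRAMING (cell contract, verbatim): «discharging `BetaPertH` makes Bałaban's UV stability UNCONDITIONAL —
a real constructive-QFT result; it is NOT the continuum limit and NOT the Clay problem.»  ABSOLUTE RULE (cell charter, verbatim): «No internally-minted
statement may enter as a cited fact. Every hypothesis is either kernel-proved in this package or a verbatim quotation of a PUBLISHED theorem with page
reference. The manuscript(s) under audit are NOT citable for their own disputed steps — they are the thing under adjudication; programme-internal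
(2001/route/tribunal) claims are never citable.»  Row D1 ∕ (C1) OWNER «beta-an2» gen 77, 2026-08-29.  No existing file touched.
-/

noncomputable section

open Finset Matrix
open scoped BigOperators
open Literature.MathematicalPhysics.QuantumFieldTheory
open Literature.MathematicalPhysics.QuantumFieldTheory.Balaban1983to89
open Literature.MathematicalPhysics.QuantumFieldTheory.Balaban1983to89.Beta
open B4TorusKernel.MultiPeriod (translate translate_injective)
open B4Reflection242 (translate_translate)
open B5Prop11Plancherel (fine)
open B6Lemma24Torus (pbox wrap)
open AffineAveraging (Site box toSite unitVec)
open AveragingContoursRooted (ctrOff ctrOff_mem_box)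
open OneStepResolventKernel (Fib)
open ExpKernelCalculus (MKer shiftK)
open Literature.MathematicalPhysics.QuantumFieldTheory.LatticeForm (quo)
open Summit.QuantumFields.BalabanUV.Beta.FP.KernelPeriodisationFib (Idx perF perZ perF_apply perZ_apply)
open Summit.QuantumFields.BalabanUV.Beta.FP.TorusGaugeCovariancePairing (wrapPt wrapPt_coe)
open Summit.QuantumFields.BalabanUV.Beta.FP.TorusCombRows (Res)
open Summit.QuantumFields.BalabanUV.Beta.FP.TorusCompositeObjects (towerTorus towerTorus_apply NParam combF bigP towerGen bigRoot bigRatio bigRatio_eq_pow towerEquiv)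
open Summit.QuantumFields.BalabanUV.Beta.FP.TorusCompositeObjectsG (compRowsSym)
open Summit.QuantumFields.BalabanUV.Beta.FP.TorusCompositeUnimodular (towerEvalC)
open Summit.QuantumFields.BalabanUV.Beta.GAN24.FineReadoutCauchyFrame (toSite_mem_range)
open Summit.QuantumFields.BalabanUV.Beta.FP.TowerK2bDoorReadoutPeriodised (wrap_eq_translate_neg_quo translate_smul_eq_smul_translate)
open Summit.QuantumFields.BalabanUV.Beta.FP.TorusReferenceBlock (sub_zsmul_quo_mem_pbox_ref treeGauge_readout_eq_reference)
open Summit.QuantumFields.BalabanUV.Beta.FP.TowerDoorGaugeRefDefs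

namespace Summit.QuantumFields.BalabanUV.Beta.FP.TowerDoorGaugeCopies

variable {d : ℕ}

/-! ## §1 Generic: a convergent column series passes through the gauge parameter and the finite read-out -/

section Generic

variable {ι κ α : Type*}

/-- [folklore] a finite matrix acts termwise on a convergent vector series: `HasSum f x ⟹ HasSum (A *ᵥ f ·) (A *ᵥ x)` (coordinatewise, `hasSum_sum` of `mul_left`). -/
theorem hasSum_mulVec [Fintype κ] (A : Matrix ι κ ℝ) {f : α → (κ → ℝ)} {x : κ → ℝ} (hf : HasSum f x) :
    HasSum (fun m => A *ᵥ f m) (A *ᵥ x) := by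
  rw [Pi.hasSum] at hf ⊢
  intro i
  simp only [Matrix.mulVec, dotProduct]
  exact hasSum_sum fun j _ => (hf j).mul_left (A i j)

/-- [folklore] **`hasSum_gaugeParam` — THE (D)-EQUATION's SOLUTION IS LINEAR IN THE COLUMN, COPY BY COPY**: `det (N·W) ≠ 0`, `(N·W) *ᵥ θ = −(N *ᵥ X)` and `HasSum X_m X` give
`HasSum (m ↦ −((N·W)⁻¹ *ᵥ (N *ᵥ X_m))) θ`. -/
theorem hasSum_gaugeParam [Fintype ι] [Fintype κ] [DecidableEq ι] {N : Matrix ι κ ℝ} {W : Matrix κ ι ℝ} (hTW : (N * W).det ≠ 0) {θ : ι → ℝ} {X : κ → ℝ}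
    (hθ : (N * W) *ᵥ θ = -(N *ᵥ X)) {Xm : α → (κ → ℝ)} (hX : HasSum Xm X) :
    HasSum (fun m => -((N * W)⁻¹ *ᵥ (N *ᵥ Xm m))) θ := by
  have e : θ = -((N * W)⁻¹ *ᵥ (N *ᵥ X)) := by
    have h : (N * W)⁻¹ *ᵥ ((N * W) *ᵥ θ) = (N * W)⁻¹ *ᵥ (-(N *ᵥ X)) := by rw [hθ]
    rwa [Matrix.mulVec_mulVec, Matrix.nonsing_inv_mul _ (isUnit_iff_ne_zero.mpr hTW), Matrix.one_mulVec, Matrix.mulVec_neg] at h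
  rw [e]
  exact (hasSum_mulVec (N * W)⁻¹ (hasSum_mulVec N hX)).neg

/-- [folklore] **`hasSum_readout`** — the `hlve`-shaped finite read-out `Σ_x [pt x = s]·(E *ᵥ θ)(eqv x)` passes to a convergent series of gauge parameters. -/
theorem hasSum_readout [Fintype ι] {ρ σ : Type*} [Fintype ρ] [DecidableEq σ] (E : Matrix ι ι ℝ) (pt : ρ → σ) (eqv : ρ → ι) (s : σ)
    {θm : α → (ι → ℝ)} {θ : ι → ℝ} (h : HasSum θm θ) :
    HasSum (fun m => ∑ x : ρ, (if pt x = s then (E *ᵥ θm m) (eqv x) else 0)) (∑ x : ρ, (if pt x = s then (E *ᵥ θ) (eqv x) else 0)) := by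
  refine hasSum_sum fun x _ => ?_
  by_cases hx : pt x = s
  · simp only [hx, if_true]
    exact (Pi.hasSum.mp (hasSum_mulVec E h)) (eqv x)
  · simp only [hx, if_false]
    exact hasSum_zero

/-- [folklore] the copy solution is homogeneous in the column: `−((N·W)⁻¹ *ᵥ (N *ᵥ (c • X))) = c • (−((N·W)⁻¹ *ᵥ (N *ᵥ X)))`. -/
theorem neg_inv_mulVec_smul [Fintype ι] [Fintype κ] [DecidableEq ι] (N : Matrix ι κ ℝ) (W : Matrix κ ι ℝ) (c : ℝ) (X : κ → ℝ) :
    -((N * W)⁻¹ *ᵥ (N *ᵥ (c • X))) = c • (-((N * W)⁻¹ *ᵥ (N *ᵥ X))) := by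
  rw [Matrix.mulVec_smul, Matrix.mulVec_smul, smul_neg]

/-- [folklore] the read-out is homogeneous: `Σ_x [pt x = s]·(E *ᵥ (c • θ))(eqv x) = c · Σ_x [pt x = s]·(E *ᵥ θ)(eqv x)`. -/
theorem readout_smul [Fintype ι] {ρ σ : Type*} [Fintype ρ] [DecidableEq σ] (E : Matrix ι ι ℝ) (pt : ρ → σ) (eqv : ρ → ι) (s : σ) (c : ℝ) (θ : ι → ℝ) :
    (∑ x : ρ, (if pt x = s then (E *ᵥ (c • θ)) (eqv x) else 0)) = c * ∑ x : ρ, (if pt x = s then (E *ᵥ θ) (eqv x) else 0) := by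
  rw [Matrix.mulVec_smul, Finset.mul_sum]
  refine Finset.sum_congr rfl fun x _ => ?_
  split_ifs
  · rw [Pi.smul_apply, smul_eq_mul]
  · rw [mul_zero]

/-- [folklore] the copy solution `−((N·W)⁻¹ *ᵥ (N *ᵥ X))` solves its own (D)-equation once `det (N·W) ≠ 0`. -/
theorem mul_mulVec_neg_inv [Fintype ι] [Fintype κ] [DecidableEq ι] {N : Matrix ι κ ℝ} {W : Matrix κ ι ℝ} (hTW : (N * W).det ≠ 0) (X : κ → ℝ) :
    (N * W) *ᵥ (-((N * W)⁻¹ *ᵥ (N *ᵥ X))) = -(N *ᵥ X) := by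
  rw [Matrix.mulVec_neg, Matrix.mulVec_mulVec, Matrix.mul_nonsing_inv _ (isUnit_iff_ne_zero.mpr hTW), Matrix.one_mulVec]

/-- [folklore] **the one-shot right inverse applied to the single-source data `c • e_a`, at a field row, is `c · XN (inl b) (inr (inl a))`.** -/
theorem toBlocks₁₂_mulVec_smul_single {β κs ρs : Type*} [Fintype β] [Fintype κs] [Fintype ρs] [DecidableEq κs]
    (XN : Matrix (β ⊕ (κs ⊕ ρs)) (β ⊕ (κs ⊕ ρs)) ℝ) (a : κs) (c : ℝ) (b : β) :
    (XN.toBlocks₁₂ *ᵥ Sum.elim (c • (Pi.single a (1 : ℝ) : κs → ℝ)) (fun _ : ρs => 0)) b = c * XN (Sum.inl b) (Sum.inr (Sum.inl a)) := by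
  rw [Matrix.mulVec, dotProduct, Fintype.sum_sum_type]
  simp only [Matrix.toBlocks₁₂, Matrix.of_apply, Sum.elim_inl, Sum.elim_inr, mul_zero, Finset.sum_const_zero, add_zero, Pi.smul_apply, smul_eq_mul]
  rw [Finset.sum_eq_single a (fun a' _ h => by rw [Pi.single_eq_of_ne h, mul_zero, mul_zero]) (fun h => absurd (Finset.mem_univ a) h),
    Pi.single_eq_same, mul_one, mul_comm]

end Generic

/-! ## §2 One source: the periodised field–multiplier column unwraps to the lattice copies -/

section Source

/-- [folklore] **`hasSum_perF_inl_source`** — for a torus `T = L • Mc` and any kernel whose copies are summable, the periodised field–multiplier entry at the source `wrapPt T (L•w)` is the series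
of the LATTICE column over the `Mc`-translates of `w`: `HasSum (m ↦ A ↑x (L • translate Mc w m) (inl κ) (inr μ)) (perF T A (x, inl κ) (wrapPt T (L•w), inr μ))`. -/
theorem hasSum_perF_inl_source (L : ℕ) (T Mc : Fin (3 + 1) → ℕ) [∀ i, NeZero (T i)] [∀ i, NeZero (Mc i)] (hT : ∀ i, T i = L * Mc i)
    (A : MKer (3 + 1) (Fib 3)) (x : ↥(pbox T)) (κ μ : Fin (3 + 1)) (w : Site (3 + 1))
    (hs : Summable (fun m : Site (3 + 1) => A (x : Site (3 + 1)) (((L : ℕ) : ℤ) • translate Mc w m) (Sum.inl κ) (Sum.inr μ))) :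
    HasSum (fun m : Site (3 + 1) => A (x : Site (3 + 1)) (((L : ℕ) : ℤ) • translate Mc w m) (Sum.inl κ) (Sum.inr μ))
      (perF T A (x, Sum.inl κ) (wrapPt T (((L : ℕ) : ℤ) • w), Sum.inr μ)) := by
  rw [perF_apply, perZ_apply]
  simp only [wrapPt_coe]
  set q : Site (3 + 1) := Summit.QuantumFields.BalabanUV.Beta.GAN24.KernelPeriodisation.quo T (((L : ℕ) : ℤ) • w) with hq
  have e : ∀ m : Site (3 + 1), A (x : Site (3 + 1)) (translate T (wrap T (((L : ℕ) : ℤ) • w)) m) (Sum.inl κ) (Sum.inr μ)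
      = A (x : Site (3 + 1)) (((L : ℕ) : ℤ) • translate Mc w (-q + m)) (Sum.inl κ) (Sum.inr μ) := by
    intro m
    rw [wrap_eq_translate_neg_quo, ← hq, translate_translate, translate_smul_eq_smul_translate L T Mc hT]
  simp_rw [e]
  have e2 : (∑' m : Site (3 + 1), A (x : Site (3 + 1)) (((L : ℕ) : ℤ) • translate Mc w (-q + m)) (Sum.inl κ) (Sum.inr μ))
      = ∑' m : Site (3 + 1), A (x : Site (3 + 1)) (((L : ℕ) : ℤ) • translate Mc w m) (Sum.inl κ) (Sum.inr μ) :=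
    (Equiv.addLeft (-q)).tsum_eq (fun m : Site (3 + 1) => A (x : Site (3 + 1)) (((L : ℕ) : ℤ) • translate Mc w m) (Sum.inl κ) (Sum.inr μ))
  rw [e2]
  exact hs.hasSum

end Source

/-! ## §3 One copy: the `hlve` word of the copy's gauge parameter on the box is `−λℤ` (road (C6) + PART 55) -/

section Copy

variable (Lc : ℕ) [NeZero Lc] (M : Fin (d + 1) → ℕ) [∀ μ, NeZero (M μ)] (lev : ℕ → ℕ) (rs : ℕ → (Fin (d + 1) → ℕ))
  (hrs : ∀ k i, 0 ≤ toSite (rs k) i ∧ toSite (rs k) i < (Lc : ℤ)) (hM : ∀ i, Lc ∣ M i) (n : ℕ)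
include hM

/-- [folklore] **`treeGauge_readout_eq_neg_lamZ` — ONE COPY**: at (C6)'s letters on the box `M` (generic root list; G-2's `det ≠ 0` displayed on the box AND on the reference tower), for an `L`-block
covariant kernel `A` (`shiftK (−L•t) A = A`, `L = bigRatio Lc (n+1)`), if `θ` solves `(N·W₀)·θ = −N·X_z` for the lattice column `X_z b = A ↑b.1 (L•z) (inl b.2) (inr μ)`, then its `hlve` word at the finest
site `s` is `−lamZ Lc lev rs hrs n A μ z ↑s` — (C6) `treeGauge_readout_eq_reference` with `X′ := refCol … (z − quo L ↑s)`, `θ′ := refTheta …`; the column agreement is the block covariance. -/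
theorem treeGauge_readout_eq_neg_lamZ
    {Q₁₀ : Matrix (↥(pbox M) × Fin (d + 1)) (↥(pbox (towerTorus Lc M (n + 1))) × Fin (d + 1)) ℝ} (hQ₁₀ : Q₁₀ = compRowsSym Lc M lev rs (n + 1))
    {τ₁ : Matrix (NParam Lc (fine Lc M) (fun k => rs (k + 1)) n) (↥(pbox (towerTorus Lc M (n + 1))) × Fin (d + 1)) ℝ}
    (hτ₁ : τ₁ = bigP Lc (fine Lc M) (fun k => rs (k + 1)) (fun k => hrs (k + 1)) n)
    {τ₂ : Matrix (Res (toSite (rs 0)) Lc M) (↥(pbox M) × Fin (d + 1)) ℝ} (hτ₂ : τ₂ = combF Lc M (rs 0))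
    {N : Matrix (NParam Lc M rs (n + 1)) (↥(pbox (towerTorus Lc M (n + 1))) × Fin (d + 1)) ℝ} (hN : N = Matrix.fromRows (τ₂ * Q₁₀) τ₁)
    {W₀ : Matrix (↥(pbox (towerTorus Lc M (n + 1))) × Fin (d + 1)) (NParam Lc M rs (n + 1)) ℝ} (hW₀ : W₀ = towerGen Lc M rs (n + 1))
    {E : Matrix (NParam Lc M rs (n + 1)) (NParam Lc M rs (n + 1)) ℝ} (hE : E = towerEvalC Lc M rs hrs (n + 1))
    (hTW : (N * W₀).det ≠ 0)
    (hTW' : (refSlice Lc lev rs hrs n * towerGen Lc (fun _ : Fin (d + 1) => Lc) rs (n + 1)).det ≠ 0)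
    (A : MKer (d + 1) (Fib d)) (hA : ∀ t : Site (d + 1), shiftK (-(((bigRatio Lc (n + 1) : ℕ) : ℤ) • t)) A = A)
    (μ : Fin (d + 1)) (z : Site (d + 1)) {θ : NParam Lc M rs (n + 1) → ℝ}
    (hθ : (N * W₀) *ᵥ θ = -(N *ᵥ fun b : ↥(pbox (towerTorus Lc M (n + 1))) × Fin (d + 1) =>
      A (b.1 : Site (d + 1)) (((bigRatio Lc (n + 1) : ℕ) : ℤ) • z) (Sum.inl b.2) (Sum.inr μ)))
    (s : ↥(pbox (towerTorus Lc M (n + 1)))) :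
    (∑ x : Res (bigRoot Lc rs (n + 1)) (bigRatio Lc (n + 1)) (towerTorus Lc M (n + 1)),
        (if (x.1 : ↥(pbox (towerTorus Lc M (n + 1)))) = s then (E *ᵥ θ) (towerEquiv Lc M rs hrs (n + 1) x) else 0))
      = -lamZ Lc lev rs hrs n A μ z (s : Site (d + 1)) := by
  rw [lamZ_eq, neg_neg]
  exact treeGauge_readout_eq_reference Lc M lev rs hrs hM n hQ₁₀ hτ₁ hτ₂ hN hW₀ hE rfl rfl rfl (refSlice_eq Lc lev rs hrs n) rfl rfl hTW hTW' hθ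
    (refSlice_mul_towerGen_mulVec_refTheta Lc lev rs hrs n A hTW' μ (z - quo (bigRatio Lc (n + 1)) (s : Site (d + 1)))) s
    (fun b b' h1 h2 _ _ => by
      have e := congrFun (congrFun (congrFun (congrFun (hA (quo (bigRatio Lc (n + 1)) (s : Site (d + 1)))) (b.1 : Site (d + 1)))
        (((bigRatio Lc (n + 1) : ℕ) : ℤ) • z)) (Sum.inl b.2)) (Sum.inr μ)
      rw [refCol_apply, h1, h2, ← e]
      simp only [shiftK, smul_add, smul_neg, sub_eq_add_neg])

end Copy

end Summit.QuantumFields.BalabanUV.Beta.FP.TowerDoorGaugeCopies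

end
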